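import Summits.CriticalPhenomena.PercolationContinuityZ3.Theorems.PercNearOneGluingNoHeavyLowerTailCILGlueLeadPersistence
import Summits.CriticalPhenomena.PercolationContinuityZ3.Theorems.PercNearOneGluingNoHeavyLowerTailCILAveragedPortForward
import HarnessLib

/-!
# `NoHeavyLowerTail` (stmt-CriticalPhenomena-4575) — forward-greedy enumerations exist (FG-EXIST)

Support file (prover `prim-lf-3`, lemma factory #3, gen 5; `--supports stmt-CriticalPhenomena-4575`).  No definitions, no named
facts, no sorries.

`AveragedPort.bad_le_firstOpenSum_forward` (the averaged port lemma in the champion-first order) assumes a FORWARD-GREEDY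
enumeration `p 0, …, p (d−1)` of the ports of the observer `o`: for `l < m` the port `p l` is at least as light as `p m` in the graph
`w^{[l]}` (`w` with the pairs `o–p i`, `i ≤ l`, deleted).  Here such an enumeration is CONSTRUCTED for every finite set `P` of
candidate ports with `o ∉ P` and coin weights `w s(o,q) < 1` (`exists_forwardGreedy`): take `p 0` of maximal lightness in `w`, then
recurse in `w[s(o, p 0) ↦ 0]` on `P ∖ {p 0}`; the step "the champion of the current graph dominates every other port once its own
coin is deleted" is `ExchangeTools.forwardGreedy_step` (glue-lead persistence).  Consequently the forward averaged port lemma holds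
for every relay-neighboured observer with coins `< 1`, with no enumeration hypothesis (`bad_le_firstOpenSum_forward_exists`).
ttrl2 census of the existence claim: `run/shared/lean/ttrl/starm/FGEXIST.md` (0 failures / 1 489 005 exact instances).
-/

noncomputable section

namespace Summit.CriticalPhenomena.PercolationContinuityZ3.Theorems

open MeasureTheory Set Literature.Probability.LatticeModels Literature.Probability.Percolation
open scoped Classical BigOperators

variable {n : ℕ}

namespace AveragedPort

/-- **Forward-greedy enumerations exist.**  For every finite set `P` of vertices with `o ∉ P` and `w s(o,q) < 1` for `q ∈ P`
there is an injective enumeration `p : Fin P.card → Fin n` of `P` such that for all `l < m` the vertex `p l` is at least as light as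
`p m` in `w^{[l]} = (e ↦ if ∃ i ≤ l, e = s(o, p i) then 0 else w e)`.  Construction: `p 0` = a lightness maximiser in `w`; recurse on
`P.erase (p 0)` with the weight `w[s(o, p 0) ↦ 0]`; the first step is `ExchangeTools.forwardGreedy_step`. [this file] -/
theorem exists_forwardGreedy (A : Finset (Fin n)) (o : Fin n) (j : ℕ) :
    ∀ (d : ℕ) (w : Sym2 (Fin n) → unitInterval) (P : Finset (Fin n)), P.card = d → o ∉ P →
      (∀ q ∈ P, ((w s(o, q) : unitInterval) : ℝ) < 1) →
      ∃ p : Fin d → Fin n, Function.Injective p ∧ (∀ l, p l ∈ P) ∧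
        (∀ l m : Fin d, l < m →
          (prodBernoulli (fun e => if (∃ i : Fin d, i ≤ l ∧ e = s(o, p i)) then (0 : unitInterval) else w e)).real
              {ω : BondConfig (Fin n) | (A.filter fun z => ω ∈ openConn (p m) z).card ≤ j} ≤
            (prodBernoulli (fun e => if (∃ i : Fin d, i ≤ l ∧ e = s(o, p i)) then (0 : unitInterval) else w e)).real
              {ω : BondConfig (Fin n) | (A.filter fun z => ω ∈ openConn (p l) z).card ≤ j}) := by
  intro d
  induction d with
  | zero =>
    intro w P _ _ _
    exact ⟨Fin.elim0, fun i => Fin.elim0 i, fun i => Fin.elim0 i, fun i => Fin.elim0 i⟩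
  | succ d ih =>
    intro w P hcard hoP hlt
    -- lightness in `w`
    set f : Fin n → ℝ := fun v =>
      (prodBernoulli w).real {ω : BondConfig (Fin n) | (A.filter fun z => ω ∈ openConn v z).card ≤ j} with hf
    have hne : P.Nonempty := by rw [← Finset.card_pos, hcard]; exact Nat.succ_pos d
    obtain ⟨q, hqP, hqmax⟩ := Finset.exists_max_image P f hne
    have hqo : q ≠ o := fun h => hoP (h ▸ hqP)
    -- recurse with the coin of `q` deleted
    set w' : Sym2 (Fin n) → unitInterval := Function.update w s(o, q) 0 with hw'
    set P' := P.erase q with hP'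
    have hcard' : P'.card = d := by rw [hP', Finset.card_erase_of_mem hqP, hcard]; rfl
    have hoP' : o ∉ P' := fun h => hoP (Finset.mem_of_mem_erase h)
    have hpair : ∀ r ∈ P', s(o, r) ≠ s(o, q) := by
      intro r hr h
      rw [Sym2.eq_iff] at h
      rcases h with ⟨-, h⟩ | ⟨h, -⟩
      · exact (Finset.ne_of_mem_erase hr) h
      · exact hqo h.symm
    have hlt' : ∀ r ∈ P', ((w' s(o, r) : unitInterval) : ℝ) < 1 := by
      intro r hr
      rw [hw', Function.update_of_ne (hpair r hr)]
      exact hlt r (Finset.mem_of_mem_erase hr)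
    obtain ⟨p', hp'inj, hp'P, hp'FG⟩ := ih w' P' hcard' hoP' hlt'
    refine ⟨Fin.cons q p', ?_, ?_, ?_⟩
    · -- injective
      rw [Fin.cons_injective_iff]
      refine ⟨?_, hp'inj⟩
      rintro ⟨i, hi⟩
      exact Finset.ne_of_mem_erase (hp'P i) hi
    · -- values in P
      intro l
      refine Fin.cases ?_ (fun i => ?_) l
      · simpa using hqP
      · simpa using Finset.mem_of_mem_erase (hp'P i)
    · -- forward-greedy
      intro l m hlm
      have hm0 : m ≠ 0 := fun h => by rw [h] at hlm; exact (Fin.not_lt_zero l) hlm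
      obtain ⟨m', rfl⟩ := Fin.eq_succ_of_ne_zero hm0
      -- the deleted-pairs weight after `p 0 = q` alone is `w'`
      have hW0 : (fun e => if (∃ i : Fin (d + 1), i ≤ (0 : Fin (d + 1)) ∧ e = s(o, (Fin.cons q p' : Fin (d + 1) → Fin n) i))
          then (0 : unitInterval) else w e) = w' := by
        funext e
        by_cases he : e = s(o, q)
        · rw [he, hw', Function.update_self, if_pos]
          exact ⟨0, le_rfl, by simp⟩
        · rw [hw', Function.update_of_ne he, if_neg]
          rintro ⟨i, hi, hie⟩
          rw [Fin.le_zero_iff] at hi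
          rw [hi] at hie
          exact he (by simpa using hie)
      -- the deleted-pairs weight after `p 0..p (l'+1)` is the recursive one after `p' 0..p' l'`
      have hWsucc : ∀ l' : Fin d,
          (fun e => if (∃ i : Fin (d + 1), i ≤ l'.succ ∧ e = s(o, (Fin.cons q p' : Fin (d + 1) → Fin n) i))
            then (0 : unitInterval) else w e) =
          (fun e => if (∃ i : Fin d, i ≤ l' ∧ e = s(o, p' i)) then (0 : unitInterval) else w' e) := by
        intro l'
        funext e
        by_cases h1 : ∃ i : Fin d, i ≤ l' ∧ e = s(o, p' i)
        · rw [if_pos h1, if_pos]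
          obtain ⟨i, hi, hie⟩ := h1
          exact ⟨i.succ, Fin.succ_le_succ_iff.2 hi, by simpa using hie⟩
        · rw [if_neg h1]
          by_cases he : e = s(o, q)
          · rw [he, hw', Function.update_self, if_pos]
            exact ⟨0, Fin.zero_le _, by simp⟩
          · rw [hw', Function.update_of_ne he, if_neg]
            rintro ⟨i, hi, hie⟩
            rcases Fin.eq_zero_or_eq_succ i with rfl | ⟨i', rfl⟩
            · exact he (by simpa using hie)
            · exact h1 ⟨i', Fin.succ_le_succ_iff.1 hi, by simpa using hie⟩
      by_cases hl0 : l = 0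
      · -- first step: `q` is the champion of `w`, so it dominates `p' m'` in `w'`
        subst hl0
        rw [hW0]
        have hdom : f (p' m') ≤ f q := hqmax (p' m') (Finset.mem_of_mem_erase (hp'P m'))
        have := ExchangeTools.forwardGreedy_step w A o q (p' m') j hqo (hlt q hqP) hdom
        simpa [hw'] using this
      · obtain ⟨l', rfl⟩ := Fin.eq_succ_of_ne_zero hl0
        have hlm' : l' < m' := Fin.succ_lt_succ_iff.1 hlm
        rw [hWsucc l']
        simpa using hp'FG l' m' hlm'

/-- **Averaged port domination, forward order, no enumeration hypothesis.**  For a relay-neighboured observer `o ∉ A` whose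
positive-weight pairs all go to a set `P ⊆ A` of ports with coin weights `< 1`, there is a forward-greedy enumeration `p` of `P`
(by `exists_forwardGreedy`), and for it `μ{1 ≤ N ≤ j} ≤ Σ_l μ(F_l)·μ{|π(p l)| ≤ j}` (`F_l` = "`p l` is the first open port"),
by `bad_le_firstOpenSum_forward`. [this file] -/
theorem bad_le_firstOpenSum_forward_exists (w : Sym2 (Fin n) → unitInterval) (A : Finset (Fin n)) (o : Fin n) (j : ℕ)
    (P : Finset (Fin n)) (hPA : P ⊆ A) (hoA : o ∉ A)
    (hobs : ∀ v, w s(o, v) ≠ 0 → v ∈ P) (hlt : ∀ q ∈ P, ((w s(o, q) : unitInterval) : ℝ) < 1) :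
    ∃ p : Fin P.card → Fin n, Function.Injective p ∧ (∀ l, p l ∈ P) ∧
      (∀ l m : Fin P.card, l < m →
        (prodBernoulli (fun e => if (∃ i : Fin P.card, i ≤ l ∧ e = s(o, p i)) then (0 : unitInterval) else w e)).real
            {ω : BondConfig (Fin n) | (A.filter fun z => ω ∈ openConn (p m) z).card ≤ j} ≤
          (prodBernoulli (fun e => if (∃ i : Fin P.card, i ≤ l ∧ e = s(o, p i)) then (0 : unitInterval) else w e)).real
            {ω : BondConfig (Fin n) | (A.filter fun z => ω ∈ openConn (p l) z).card ≤ j}) ∧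
      (prodBernoulli w).real {ω : BondConfig (Fin n) |
          1 ≤ (A.filter fun z => ω ∈ openConn o z).card ∧ (A.filter fun z => ω ∈ openConn o z).card ≤ j} ≤
        ∑ l : Fin P.card, (prodBernoulli w).real {ω : BondConfig (Fin n) | s(o, p l) ∈ ω ∧ ∀ m, m < l → s(o, p m) ∉ ω} *
          (prodBernoulli w).real {ω : BondConfig (Fin n) | (A.filter fun z => ω ∈ openConn (p l) z).card ≤ j} := by
  have hoP : o ∉ P := fun h => hoA (hPA h)
  obtain ⟨p, hpinj, hpP, hFG⟩ := exists_forwardGreedy A o j P.card w P rfl hoP hlt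
  refine ⟨p, hpinj, hpP, hFG, ?_⟩
  -- every positive-weight neighbour of `o` is some `p l` (the enumeration is onto `P`)
  have hsurj : ∀ v ∈ P, ∃ l, v = p l := by
    have himage : Finset.univ.image p = P := by
      apply Finset.eq_of_subset_of_card_le
      · intro v hv
        obtain ⟨l, -, rfl⟩ := Finset.mem_image.1 hv
        exact hpP l
      · rw [Finset.card_image_of_injective _ hpinj, Finset.card_univ, Fintype.card_fin]
    intro v hv
    rw [← himage] at hv
    obtain ⟨l, -, hl⟩ := Finset.mem_image.1 hv
    exact ⟨l, hl.symm⟩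
  have hobs' : ∀ v, w s(o, v) ≠ 0 → ∃ l, v = p l := fun v hv => hsurj v (hobs v hv)
  exact bad_le_firstOpenSum_forward P.card w A o j p hpinj (fun l => hPA (hpP l)) hoA hobs' hFG

end AveragedPort

end Summit.CriticalPhenomena.PercolationContinuityZ3.Theorems

end
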